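import Literature.Computability.AlgebraicComplexity.EquivariantDC
import Literature.Computability.AlgebraicComplexity.LinSubstProofs
import HarnessLib

/-!
# Equivalence of (affine) determinantal representations up to symmetries

Topic: `Literature/Computability/AlgebraicComplexity`. Definition request `defn-DetReprEquivalent`
(route `ValiantsHypothesis/GrenetRigidity`, items `OptimalUnique` stmt-ValiantsHypothesis-3735 and
`OptimalUniqueThree` stmt-ValiantsHypothesis-3738, which inline exactly this relation).

## Content

* `DetReprEquivalent Γ A B` — two square matrices `A, B` over `MvPolynomial σ k` (typically affine
  determinantal representations of the same polynomial) are **equivalent** when `B` is obtained from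
  `A` by a linear substitution of the variables `γ ∈ Γ` (`Matrix.linSubstEntries`, `EquivariantDC.lean`),
  an optional matrix transposition, and two-sided multiplication by constant invertible matrices:
  `B = P · A(γ·x) · Q` or `B = P · A(γ·x)ᵀ · Q` with `P, Q ∈ GL_ι(k)`, `γ ∈ Γ`.
  This is "the same orbit under `GL × GL × Γ × ℤ₂`": the gauge group of `det` is generated by
  `X ↦ g X h` and `X ↦ Xᵀ` (Frobenius; Landsberg 2017, Thm. 6.6.1.1; Landsberg–Ressayre 2017, §1:
  `𝔾_{det_n} ≅ (GL(E) × GL(F))/ℂ* ⋊ ℤ₂`), and `Γ` is a chosen group of symmetries of the represented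
  polynomial acting by substitution (for `perm_m`: `permSymmetrySubst k m` of `LandsbergRessayre.lean`,
  i.e. monomial row/column substitutions and `x ↦ xᵀ`; Landsberg–Ressayre 2017, §2.1). It is the
  relation "equivalent under the two group actions" of Hüttenhain–Ikenmeyer 2016, Prop. 9 (there over
  `ℤ`, binary variable matrices, `Γ = 𝔖₃ × 𝔖₃ ⋊ ⟨x ↦ xᵀ⟩`), and the "unique up to trivialities" of
  Landsberg 2017, Thm. 7.4.1.1.
* It is an equivalence relation (`refl/symm/trans`, `DetReprEquivalent.setoid`), generated by and closed
  under the three elementary moves (`mul_mul`, `transpose`, `linSubstEntries`); `Γ = ⊥` is pure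
  gauge-and-transpose equivalence (`detReprEquivalent_bot_iff`); monotone in `Γ`.
* It preserves affine entries (`DetReprEquivalent.totalDegree_le`) and transforms determinants by
  `det B = C(det P · det Q) · (γ · det A)` (`DetReprEquivalent.exists_det_eq`): when `A` and `B` represent
  the same `f`, no determinant condition on `(P, Q, γ)` need be imposed (`exists_eq_C_mul_linSubst`).
* Link with `IsEquivariantDetRepr Γ f A` (`EquivariantDC.lean`): `A` is `Γ`-equivariant iff every
  `A(γ·x)`, `γ ∈ Γ`, is obtained from `A` by the gauge move ALONE (`isEquivariantDetRepr_iff_exists_mul_mul`,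
  exact-lift form), hence is `⊥`-equivalent to `A`; and equivariance is a property of the
  `DetReprEquivalent Γ`-class among representations of `f` (`IsEquivariantDetRepr.of_detReprEquivalent`).

## Sources

* J. Hüttenhain, C. Ikenmeyer, *Binary determinantal complexity*, Linear Algebra Appl. 504 (2016)
  559–573 = arXiv:1410.8202, §4, Prop. 9 (all 463 binary `7 × 7` matrices with `det = per₃` are one
  orbit of `{(g,h) : det g = det h} ⊆ GL₇(ℤ)²` with transposition, and `𝔖₃ × 𝔖₃`, `x ↦ xᵀ` on the
  variables) (key `HuttenhainIkenmeyer2016`).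
* J. M. Landsberg, N. Ressayre, *Permanent v. determinant: an exponential lower bound assuming symmetry
  and a potential path towards Valiant's conjecture*, Differential Geom. Appl. 55 (2017) 146–166 =
  arXiv:1508.05788, §1 (`G_P`, `𝔾_{det_n} ≅ (GL_n × GL_n)/ℂ* ⋊ ℤ₂`, `τ(A,B) : x ↦ A x B⁻¹`), Defs. 1.2–1.3,
  §2.1 (`𝔾_{perm_m}`) (key `LandsbergRessayre2017`).
* J. M. Landsberg, *Geometry and Complexity Theory*, CUP 2017, Thm. 6.6.1.1 (Frobenius: the linear
  symmetries of `det_n` are `z ↦ g z h` and `z ↦ g zᵀ h`), Def. 7.4.1.2 and Thm. 7.4.1.1 ("optimal and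
  unique up to trivialities") (key `Landsberg2017`).

## Design choices (read before use)

* NORMAL FORM. Every word in the three moves can be brought to the form `P · A(γ·x)^{(ᵀ)} · Q`
  (substitution commutes with constant multiplication and with transposition; transposing a two-sided
  product swaps and transposes the constant factors), so the existential normal form loses nothing:
  see the closure lemmas `DetReprEquivalent.mul_mul/transpose/linSubstEntries`.
* NO DETERMINANT MATCHING on `(P, Q)` (HI16 ask `det g = det h`, Frobenius `det g · det h = 1`): as a
  relation between two representations of the SAME `f` this is automatic up to the character of `γ`
  (`exists_eq_C_mul_linSubst`), and the requesting route wants the coarse orbit relation.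
* GENERALITY. Any commutative ring `k`, any finite index type `ι` (the route uses `ι = Fin m`, `k = ℂ`),
  any subgroup `Γ ≤ GL σ k` (not required to fix `f`).
* NOT HERE: invariance of block-decomposability (`IsBlockDecomposable`, companion request
  `defn-IsBlockDecomposable`, not yet in the tree) — it follows from the closure lemmas once that notion
  lands (the transpose move reverses the block pattern, to be re-sorted by a permutation matrix); the
  symmetry groups themselves (`LandsbergRessayre.lean`).
-/

noncomputable section

open MvPolynomial Matrix

namespace Literature.Computability.AlgebraicComplexity

universe u v w

variable {k : Type u} [CommRing k] {σ : Type v}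

/-! ## Algebra of substituted matrices and constant gauge factors -/

section Subst

variable [Fintype σ] [DecidableEq σ] {ι : Type w}

/-- Entries of the substituted matrix: `A(γ·x)ᵢⱼ = γ · Aᵢⱼ`. [folklore] -/
theorem Matrix.linSubstEntries_apply (γ : GL σ k) (A : Matrix ι ι (MvPolynomial σ k)) (i j : ι) :
    Matrix.linSubstEntries γ A i j = linSubst σ k (γ : Matrix σ σ k) (A i j) := rfl

/-- Substitution of variables is multiplicative on matrices: `(M N)(γ·x) = M(γ·x) N(γ·x)`
(`linSubst γ` is a ring homomorphism). [folklore] -/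
theorem Matrix.linSubstEntries_mul [Fintype ι] (γ : GL σ k) (M N : Matrix ι ι (MvPolynomial σ k)) :
    Matrix.linSubstEntries γ (M * N) = Matrix.linSubstEntries γ M * Matrix.linSubstEntries γ N := by
  simp only [Matrix.linSubstEntries, Matrix.map_mul]

/-- Substitution of variables fixes constant matrices. [folklore] -/
@[simp] theorem Matrix.linSubstEntries_map_C (γ : GL σ k) (P : Matrix ι ι k) :
    Matrix.linSubstEntries γ (P.map C : Matrix ι ι (MvPolynomial σ k)) = P.map C := by
  ext i j
  simp [Matrix.linSubstEntries]

/-- Substitution of variables commutes with transposition. [folklore] -/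
theorem Matrix.linSubstEntries_transpose (γ : GL σ k) (M : Matrix ι ι (MvPolynomial σ k)) :
    Matrix.linSubstEntries γ Mᵀ = (Matrix.linSubstEntries γ M)ᵀ := by
  simp only [Matrix.linSubstEntries, Matrix.transpose_map]

/-- Iterated substitution: `(A(δ·x))(γ·x) = A((γδ)·x)` (the substitution action is a left action,
`linSubst_mul`). [folklore] -/
theorem Matrix.linSubstEntries_linSubstEntries (γ δ : GL σ k) (M : Matrix ι ι (MvPolynomial σ k)) :
    Matrix.linSubstEntries γ (Matrix.linSubstEntries δ M) = Matrix.linSubstEntries (γ * δ) M := by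
  ext i j
  simp only [Matrix.linSubstEntries, Matrix.map_apply, Units.val_mul, linSubst_mul, AlgHom.comp_apply]

/-- `γ⁻¹` undoes `γ` on the entries. [folklore] -/
@[simp] theorem Matrix.linSubstEntries_inv_linSubstEntries (γ : GL σ k)
    (M : Matrix ι ι (MvPolynomial σ k)) :
    Matrix.linSubstEntries γ⁻¹ (Matrix.linSubstEntries γ M) = M := by
  rw [Matrix.linSubstEntries_linSubstEntries, inv_mul_cancel, Matrix.linSubstEntries_one]

/-- Substitution of variables does not raise the total degree of the entries
(`totalDegree_linSubst_le_holds`, Landsberg 2017 §1.2.5). [folklore] -/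
theorem totalDegree_linSubstEntries_le {d : ℕ} (γ : GL σ k) {M : Matrix ι ι (MvPolynomial σ k)}
    (hM : ∀ i j, (M i j).totalDegree ≤ d) (i j : ι) :
    ((Matrix.linSubstEntries γ M) i j).totalDegree ≤ d :=
  (totalDegree_linSubst_le_holds (γ : Matrix σ σ k) (M i j)).trans (hM i j)

/-- `det (A(γ·x)) = γ · det A`: substitution is a ring homomorphism (`AlgHom.map_det`). [folklore] -/
theorem det_linSubstEntries [Fintype ι] [DecidableEq ι] (γ : GL σ k) (A : Matrix ι ι (MvPolynomial σ k)) :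
    (Matrix.linSubstEntries γ A).det = linSubst σ k (γ : Matrix σ σ k) A.det := by
  simp only [Matrix.linSubstEntries]
  exact (AlgHom.map_det (linSubst σ k (γ : Matrix σ σ k)) A).symm

end Subst

section Constants

variable {ι : Type w} [Fintype ι] [DecidableEq ι]

/-- The transpose of an invertible matrix as an invertible matrix (over a commutative ring,
`(P⁻¹)ᵀ` is the inverse of `Pᵀ`). [folklore] -/
def transposeGL (P : GL ι k) : GL ι k where
  val := (P : Matrix ι ι k)ᵀ
  inv := ((P⁻¹ : GL ι k) : Matrix ι ι k)ᵀ
  val_inv := by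
    rw [← Matrix.transpose_mul, ← Units.val_mul, inv_mul_cancel, Units.val_one, Matrix.transpose_one]
  inv_val := by
    rw [← Matrix.transpose_mul, ← Units.val_mul, mul_inv_cancel, Units.val_one, Matrix.transpose_one]

/-- `transposeGL P` is `Pᵀ`. [folklore] -/
@[simp] theorem coe_transposeGL (P : GL ι k) :
    ((transposeGL P : GL ι k) : Matrix ι ι k) = (P : Matrix ι ι k)ᵀ := rfl

/-- Left cancellation of a constant gauge factor: `P⁻¹ · (P · X) = X`. [folklore] -/
theorem inv_map_C_mul_cancel_left (P : GL ι k) (X : Matrix ι ι (MvPolynomial σ k)) :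
    ((P⁻¹ : GL ι k) : Matrix ι ι k).map C * ((P : Matrix ι ι k).map C * X) = X := by
  rw [← Matrix.mul_assoc, ← Matrix.map_mul, ← Units.val_mul, inv_mul_cancel, Units.val_one,
    Matrix.map_one C C_0 C_1, Matrix.one_mul]

/-- Left cancellation of a constant gauge factor: `P · (P⁻¹ · X) = X`. [folklore] -/
theorem map_C_mul_inv_cancel_left (P : GL ι k) (X : Matrix ι ι (MvPolynomial σ k)) :
    ((P : GL ι k) : Matrix ι ι k).map C * (((P⁻¹ : GL ι k) : Matrix ι ι k).map C * X) = X := by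
  rw [← Matrix.mul_assoc, ← Matrix.map_mul, ← Units.val_mul, mul_inv_cancel, Units.val_one,
    Matrix.map_one C C_0 C_1, Matrix.one_mul]

/-- Undoing a two-sided constant multiplication: `P⁻¹ (P M Q) Q⁻¹ = M`. [folklore] -/
theorem inv_map_C_mul_mul_map_C_inv (P Q : GL ι k) (M : Matrix ι ι (MvPolynomial σ k)) :
    ((P⁻¹ : GL ι k) : Matrix ι ι k).map C *
        ((P : Matrix ι ι k).map C * M * (Q : Matrix ι ι k).map C) *
      ((Q⁻¹ : GL ι k) : Matrix ι ι k).map C = M := by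
  have hQ : ((Q : GL ι k) : Matrix ι ι k).map C * ((Q⁻¹ : GL ι k) : Matrix ι ι k).map C =
      (1 : Matrix ι ι (MvPolynomial σ k)) := by
    rw [← Matrix.map_mul, ← Units.val_mul, mul_inv_cancel, Units.val_one, Matrix.map_one C C_0 C_1]
  simp only [Matrix.mul_assoc, hQ, Matrix.mul_one, inv_map_C_mul_cancel_left]

omit [DecidableEq ι] in
/-- Entries of `P · M · Q` (`P, Q` constant) are `k`-linear combinations of entries of `M`, so a
uniform bound on the total degree of the entries is preserved (in particular affine entries stay
affine; Mignon–Ressayre 2004, §1). [folklore] -/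
theorem totalDegree_map_C_mul_mul_map_C_le {d : ℕ} (P Q : Matrix ι ι k)
    {M : Matrix ι ι (MvPolynomial σ k)} (hM : ∀ i j, (M i j).totalDegree ≤ d) (i j : ι) :
    ((P.map C * M * Q.map C : Matrix ι ι (MvPolynomial σ k)) i j).totalDegree ≤ d := by
  simp only [Matrix.mul_apply, Matrix.map_apply]
  refine totalDegree_finsetSum_le fun b _ => (totalDegree_mul _ _).trans ?_
  rw [totalDegree_C, add_zero]
  refine totalDegree_finsetSum_le fun a _ => (totalDegree_mul _ _).trans ?_
  rw [totalDegree_C, zero_add]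
  exact hM a b

/-- `det (P.map C) = C (det P)`: determinants commute with the inclusion of constants. [folklore] -/
theorem det_map_C (P : Matrix ι ι k) : (P.map C : Matrix ι ι (MvPolynomial σ k)).det = C P.det := by
  rw [RingHom.map_det C P, RingHom.mapMatrix_apply]

/-- `det (P · M · Q) = C(det P · det Q) · det M` for constant `P, Q`. [folklore] -/
theorem det_map_C_mul_mul_map_C (P Q : Matrix ι ι k) (M : Matrix ι ι (MvPolynomial σ k)) :
    (P.map C * M * Q.map C).det = C (P.det * Q.det) * M.det := by
  rw [Matrix.det_mul, Matrix.det_mul, det_map_C, det_map_C, map_mul]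
  ring

end Constants

/-! ## The equivalence relation -/

section Defn

variable [Fintype σ] [DecidableEq σ] (Γ : Subgroup (GL σ k)) {ι : Type w} [Fintype ι] [DecidableEq ι]

/-- **Equivalence of determinantal representations up to symmetries.** `DetReprEquivalent Γ A B`:
the square matrix `B` over `MvPolynomial σ k` is obtained from `A` by a linear substitution of the
variables `γ ∈ Γ`, an optional transposition, and two-sided multiplication by constant invertible
matrices: `B = P · A(γ·x) · Q` or `B = P · A(γ·x)ᵀ · Q` with `P, Q ∈ GL_ι(k)` — i.e. `A` and `B`
lie in one orbit of `GL_ι × GL_ι × Γ × ℤ₂` (gauge group of `det`: `X ↦ g X h`, `X ↦ Xᵀ`, Frobenius /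
Landsberg 2017 Thm. 6.6.1.1, Landsberg–Ressayre 2017 §1; symmetries `Γ` of the represented polynomial
acting by substitution). This is the relation "equivalent under the two group actions" of
Hüttenhain–Ikenmeyer 2016, Prop. 9 (with no determinant matching imposed on `(P, Q)`, see the module
docstring) and the "trivialities" of Landsberg 2017, Thm. 7.4.1.1; for the permanent take
`Γ = permSymmetrySubst k m`. [cite: HuttenhainIkenmeyer2016, Prop. 9] -/
def DetReprEquivalent (A B : Matrix ι ι (MvPolynomial σ k)) : Prop :=
  ∃ (P Q : GL ι k) (γ : GL σ k), γ ∈ Γ ∧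
    (B = (P : Matrix ι ι k).map MvPolynomial.C * Matrix.linSubstEntries γ A *
          (Q : Matrix ι ι k).map MvPolynomial.C ∨
      B = (P : Matrix ι ι k).map MvPolynomial.C * (Matrix.linSubstEntries γ A)ᵀ *
          (Q : Matrix ι ι k).map MvPolynomial.C)

end Defn

section API

variable [Fintype σ] [DecidableEq σ] {Γ Γ' : Subgroup (GL σ k)} {ι : Type w} [Fintype ι] [DecidableEq ι]
  {A B B' : Matrix ι ι (MvPolynomial σ k)}

/-- Reflexivity: `A = 1 · A(1·x) · 1`. [folklore] -/
protected theorem DetReprEquivalent.refl (Γ : Subgroup (GL σ k)) (A : Matrix ι ι (MvPolynomial σ k)) :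
    DetReprEquivalent Γ A A :=
  ⟨1, 1, 1, Γ.one_mem, Or.inl (by simp [Matrix.map_one C C_0 C_1])⟩

/-- The relation is monotone in the symmetry group. [folklore] -/
theorem DetReprEquivalent.mono (h : DetReprEquivalent Γ A B) (hle : Γ ≤ Γ') :
    DetReprEquivalent Γ' A B := by
  obtain ⟨P, Q, γ, hγ, hB⟩ := h
  exact ⟨P, Q, γ, hle hγ, hB⟩

/-- Closure under the gauge move: if `A ~ B` then `A ~ P · B · Q` for constant invertible `P, Q`
(Landsberg–Ressayre 2017, §1: `GL(E) × GL(F)` acting on `det`). [cite: LandsbergRessayre2017, §1] -/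
theorem DetReprEquivalent.mul_mul (h : DetReprEquivalent Γ A B) (P Q : GL ι k) :
    DetReprEquivalent Γ A
      ((P : Matrix ι ι k).map C * B * (Q : Matrix ι ι k).map C) := by
  obtain ⟨P₀, Q₀, γ, hγ, hB⟩ := h
  refine ⟨P * P₀, Q₀ * Q, γ, hγ, ?_⟩
  rcases hB with rfl | rfl
  · left
    simp only [Units.val_mul, Matrix.map_mul, Matrix.mul_assoc]
  · right
    simp only [Units.val_mul, Matrix.map_mul, Matrix.mul_assoc]

/-- Closure under transposition: if `A ~ B` then `A ~ Bᵀ` (`(P M Q)ᵀ = Qᵀ Mᵀ Pᵀ`; the `ℤ₂` of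
`𝔾_{det_n}`, Landsberg–Ressayre 2017, §1). [cite: LandsbergRessayre2017, §1] -/
theorem DetReprEquivalent.transpose (h : DetReprEquivalent Γ A B) : DetReprEquivalent Γ A Bᵀ := by
  obtain ⟨P, Q, γ, hγ, hB⟩ := h
  refine ⟨transposeGL Q, transposeGL P, γ, hγ, ?_⟩
  rcases hB with rfl | rfl
  · right
    simp only [coe_transposeGL, Matrix.transpose_mul, Matrix.transpose_map, Matrix.mul_assoc]
  · left
    simp only [coe_transposeGL, Matrix.transpose_mul, Matrix.transpose_transpose,
      Matrix.transpose_map, Matrix.mul_assoc]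

/-- Closure under substitution by an element of `Γ`: if `A ~ B` and `δ ∈ Γ` then `A ~ B(δ·x)`
(substitution commutes with the gauge moves; Landsberg–Ressayre 2017, §1). [cite: LandsbergRessayre2017, §1] -/
theorem DetReprEquivalent.linSubstEntries (h : DetReprEquivalent Γ A B) {δ : GL σ k} (hδ : δ ∈ Γ) :
    DetReprEquivalent Γ A (Matrix.linSubstEntries δ B) := by
  obtain ⟨P, Q, γ, hγ, hB⟩ := h
  refine ⟨P, Q, δ * γ, Γ.mul_mem hδ hγ, ?_⟩
  rcases hB with rfl | rfl
  · left
    rw [Matrix.linSubstEntries_mul, Matrix.linSubstEntries_mul, Matrix.linSubstEntries_map_C,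
      Matrix.linSubstEntries_map_C, Matrix.linSubstEntries_linSubstEntries]
  · right
    rw [Matrix.linSubstEntries_mul, Matrix.linSubstEntries_mul, Matrix.linSubstEntries_map_C,
      Matrix.linSubstEntries_map_C, Matrix.linSubstEntries_transpose,
      Matrix.linSubstEntries_linSubstEntries]

/-- The three generators, (i): `A ~ P · A · Q`. [cite: LandsbergRessayre2017, §1] -/
theorem detReprEquivalent_mul_mul (Γ : Subgroup (GL σ k)) (A : Matrix ι ι (MvPolynomial σ k))
    (P Q : GL ι k) :
    DetReprEquivalent Γ A ((P : Matrix ι ι k).map C * A * (Q : Matrix ι ι k).map C) :=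
  (DetReprEquivalent.refl Γ A).mul_mul P Q

/-- The three generators, (ii): `A ~ Aᵀ`. [cite: LandsbergRessayre2017, §1] -/
theorem detReprEquivalent_transpose (Γ : Subgroup (GL σ k)) (A : Matrix ι ι (MvPolynomial σ k)) :
    DetReprEquivalent Γ A Aᵀ :=
  (DetReprEquivalent.refl Γ A).transpose

/-- The three generators, (iii): `A ~ A(γ·x)` for `γ ∈ Γ`. [cite: LandsbergRessayre2017, §1] -/
theorem detReprEquivalent_linSubstEntries (A : Matrix ι ι (MvPolynomial σ k)) {γ : GL σ k}
    (hγ : γ ∈ Γ) : DetReprEquivalent Γ A (Matrix.linSubstEntries γ A) :=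
  (DetReprEquivalent.refl Γ A).linSubstEntries hγ

/-- Undoing the gauge move: `P · M · Q ~ M`. [folklore] -/
theorem detReprEquivalent_mul_mul_left (Γ : Subgroup (GL σ k)) (P Q : GL ι k)
    (M : Matrix ι ι (MvPolynomial σ k)) :
    DetReprEquivalent Γ ((P : Matrix ι ι k).map C * M * (Q : Matrix ι ι k).map C) M := by
  have h := detReprEquivalent_mul_mul Γ
    ((P : Matrix ι ι k).map C * M * (Q : Matrix ι ι k).map C) P⁻¹ Q⁻¹
  rwa [inv_map_C_mul_mul_map_C_inv] at h

/-- Symmetry: invert the substitution, undo the transposition and the gauge factors. [folklore] -/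
protected theorem DetReprEquivalent.symm (h : DetReprEquivalent Γ A B) : DetReprEquivalent Γ B A := by
  obtain ⟨P, Q, γ, hγ, hB⟩ := h
  rcases hB with rfl | rfl
  · have h := (detReprEquivalent_mul_mul_left Γ P Q (Matrix.linSubstEntries γ A)).linSubstEntries
      (Γ.inv_mem hγ)
    rwa [Matrix.linSubstEntries_inv_linSubstEntries] at h
  · have h := ((detReprEquivalent_mul_mul_left Γ P Q
      (Matrix.linSubstEntries γ A)ᵀ).transpose).linSubstEntries (Γ.inv_mem hγ)
    rwa [Matrix.transpose_transpose, Matrix.linSubstEntries_inv_linSubstEntries] at h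

/-- Transitivity: compose the moves (transpose composes correctly: two transpositions cancel,
`Matrix.transpose_transpose`). [folklore] -/
protected theorem DetReprEquivalent.trans (h₁ : DetReprEquivalent Γ A B)
    (h₂ : DetReprEquivalent Γ B B') : DetReprEquivalent Γ A B' := by
  obtain ⟨P, Q, γ, hγ, hB'⟩ := h₂
  rcases hB' with rfl | rfl
  · exact (h₁.linSubstEntries hγ).mul_mul P Q
  · exact ((h₁.linSubstEntries hγ).transpose).mul_mul P Q

/-- `DetReprEquivalent Γ` is an equivalence relation on `ι × ι` matrices of polynomials ("the orbits
of `GL × GL × Γ × ℤ₂`"; Hüttenhain–Ikenmeyer 2016, Prop. 9). [cite: HuttenhainIkenmeyer2016, Prop. 9] -/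
theorem DetReprEquivalent.equivalence (Γ : Subgroup (GL σ k)) :
    Equivalence (DetReprEquivalent (ι := ι) Γ) :=
  ⟨DetReprEquivalent.refl Γ, DetReprEquivalent.symm, DetReprEquivalent.trans⟩

/-- The setoid of `DetReprEquivalent Γ`-classes (to speak of "one orbit" via `Quotient`).
[cite: HuttenhainIkenmeyer2016, Prop. 9] -/
def DetReprEquivalent.setoid (Γ : Subgroup (GL σ k)) (ι : Type w) [Fintype ι] [DecidableEq ι] :
    Setoid (Matrix ι ι (MvPolynomial σ k)) :=
  ⟨DetReprEquivalent Γ, DetReprEquivalent.equivalence Γ⟩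

/-- For the trivial substitution group the relation is pure gauge-and-transpose equivalence
`B = P A Q ∨ B = P Aᵀ Q` (Hüttenhain–Ikenmeyer 2016, Prop. 9, action (1)). [cite: HuttenhainIkenmeyer2016, Prop. 9] -/
theorem detReprEquivalent_bot_iff :
    DetReprEquivalent ⊥ A B ↔ ∃ P Q : GL ι k,
      B = (P : Matrix ι ι k).map C * A * (Q : Matrix ι ι k).map C ∨
        B = (P : Matrix ι ι k).map C * Aᵀ * (Q : Matrix ι ι k).map C := by
  constructor
  · rintro ⟨P, Q, γ, hγ, hB⟩
    rw [Subgroup.mem_bot] at hγ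
    subst hγ
    rw [Matrix.linSubstEntries_one] at hB
    exact ⟨P, Q, hB⟩
  · rintro ⟨P, Q, hB⟩
    exact ⟨P, Q, 1, Subgroup.one_mem _, by rwa [Matrix.linSubstEntries_one]⟩

/-! ### Entries and determinants along the relation -/

/-- The relation preserves a uniform bound on the total degree of the entries; with `d = 1`:
equivalent matrices of affine forms are matrices of affine forms (Mignon–Ressayre 2004, §1).
[folklore] -/
theorem DetReprEquivalent.totalDegree_le (h : DetReprEquivalent Γ A B) {d : ℕ}
    (hA : ∀ i j, (A i j).totalDegree ≤ d) : ∀ i j, (B i j).totalDegree ≤ d := by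
  obtain ⟨P, Q, γ, -, hB⟩ := h
  have h1 : ∀ i j, ((Matrix.linSubstEntries γ A) i j).totalDegree ≤ d :=
    totalDegree_linSubstEntries_le γ hA
  rcases hB with rfl | rfl
  · exact totalDegree_map_C_mul_mul_map_C_le _ _ h1
  · exact totalDegree_map_C_mul_mul_map_C_le _ _ fun i j => h1 j i

/-- Hence a matrix equivalent to an affine determinantal representation is an affine determinantal
representation of its own determinant. [folklore] -/
theorem DetReprEquivalent.isAffineDetRepr_det {f : MvPolynomial σ k} (h : DetReprEquivalent Γ A B)
    (hA : IsAffineDetRepr f A) : IsAffineDetRepr B.det B :=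
  ⟨h.totalDegree_le hA.1, rfl⟩

/-- Determinants along the relation: if `B = P · A(γ·x)^{(ᵀ)} · Q` then
`det B = C(det P · det Q) · (γ · det A)` (`det` is multiplicative, transpose-invariant, and commutes
with substitution). [folklore] -/
theorem DetReprEquivalent.exists_det_eq (h : DetReprEquivalent Γ A B) :
    ∃ (P Q : GL ι k) (γ : GL σ k), γ ∈ Γ ∧
      B.det = C ((P : Matrix ι ι k).det * (Q : Matrix ι ι k).det) *
        linSubst σ k (γ : Matrix σ σ k) A.det := by
  obtain ⟨P, Q, γ, hγ, hB⟩ := h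
  refine ⟨P, Q, γ, hγ, ?_⟩
  rcases hB with rfl | rfl
  · rw [det_map_C_mul_mul_map_C, det_linSubstEntries]
  · rw [det_map_C_mul_mul_map_C, Matrix.det_transpose, det_linSubstEntries]

/-- Consequently, for two representations `det A = f = det B` of the SAME polynomial the witnesses
automatically satisfy `f = C(det P · det Q) · (γ · f)`: no determinant condition on `(P, Q, γ)` needs to
be imposed in the definition (cf. Hüttenhain–Ikenmeyer 2016, Prop. 9, where `det g = det h` is
required a priori). [folklore] -/
theorem DetReprEquivalent.exists_eq_C_mul_linSubst {f : MvPolynomial σ k} (h : DetReprEquivalent Γ A B)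
    (hA : A.det = f) (hB : B.det = f) :
    ∃ (P Q : GL ι k) (γ : GL σ k), γ ∈ Γ ∧
      f = C ((P : Matrix ι ι k).det * (Q : Matrix ι ι k).det) * linSubst σ k (γ : Matrix σ σ k) f := by
  obtain ⟨P, Q, γ, hγ, e⟩ := h.exists_det_eq
  subst hA
  rw [hB] at e
  exact ⟨P, Q, γ, hγ, e⟩

/-- If moreover `Γ` fixes `f` (`Γ ≤ G_f = linStabilizer f`), then `f = C(det P · det Q) · f`.
[folklore] -/
theorem DetReprEquivalent.exists_eq_C_mul {f : MvPolynomial σ k} (h : DetReprEquivalent Γ A B)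
    (hΓ : Γ ≤ linStabilizer f) (hA : A.det = f) (hB : B.det = f) :
    ∃ P Q : GL ι k, f = C ((P : Matrix ι ι k).det * (Q : Matrix ι ι k).det) * f := by
  obtain ⟨P, Q, γ, hγ, e⟩ := h.exists_eq_C_mul_linSubst hA hB
  have hfix : linSubst σ k (γ : Matrix σ σ k) f = f := by
    simpa only [mem_linStabilizer, linSubstRep_apply] using hΓ hγ
  exact ⟨P, Q, by rwa [hfix] at e⟩

/-! ### Transport of gauge lifts along the relation -/

/-- Gauge lifts survive the gauge move: if every `M(γ·x)`, `γ ∈ Γ`, is `P_γ · M · Q_γ`, the same holds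
for `P · M · Q` (conjugate the lifts). [folklore] -/
theorem forall_exists_lift_mul_mul {M : Matrix ι ι (MvPolynomial σ k)}
    (hM : ∀ γ ∈ Γ, ∃ P Q : GL ι k, Matrix.linSubstEntries γ M =
      (P : Matrix ι ι k).map C * M * (Q : Matrix ι ι k).map C)
    (P₀ Q₀ : GL ι k) :
    ∀ γ ∈ Γ, ∃ P Q : GL ι k,
      Matrix.linSubstEntries γ ((P₀ : Matrix ι ι k).map C * M * (Q₀ : Matrix ι ι k).map C) =
        (P : Matrix ι ι k).map C * ((P₀ : Matrix ι ι k).map C * M * (Q₀ : Matrix ι ι k).map C) *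
          (Q : Matrix ι ι k).map C := by
  intro γ hγ
  obtain ⟨P, Q, e⟩ := hM γ hγ
  refine ⟨P₀ * P * P₀⁻¹, Q₀⁻¹ * Q * Q₀, ?_⟩
  rw [Matrix.linSubstEntries_mul, Matrix.linSubstEntries_mul, Matrix.linSubstEntries_map_C,
    Matrix.linSubstEntries_map_C, e]
  simp only [Units.val_mul, Matrix.map_mul, Matrix.mul_assoc, inv_map_C_mul_cancel_left,
    map_C_mul_inv_cancel_left]

/-- Gauge lifts survive transposition: `Mᵀ(γ·x) = (M(γ·x))ᵀ = Q_γᵀ · Mᵀ · P_γᵀ`. [folklore] -/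
theorem forall_exists_lift_transpose {M : Matrix ι ι (MvPolynomial σ k)}
    (hM : ∀ γ ∈ Γ, ∃ P Q : GL ι k, Matrix.linSubstEntries γ M =
      (P : Matrix ι ι k).map C * M * (Q : Matrix ι ι k).map C) :
    ∀ γ ∈ Γ, ∃ P Q : GL ι k,
      Matrix.linSubstEntries γ Mᵀ = (P : Matrix ι ι k).map C * Mᵀ * (Q : Matrix ι ι k).map C := by
  intro γ hγ
  obtain ⟨P, Q, e⟩ := hM γ hγ
  refine ⟨transposeGL Q, transposeGL P, ?_⟩
  rw [Matrix.linSubstEntries_transpose, e]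
  simp only [coe_transposeGL, Matrix.transpose_mul, Matrix.transpose_map, Matrix.mul_assoc]

/-- Gauge lifts survive substitution by `δ ∈ Γ`: `(M(δ·x))(γ·x) = M((γδ)·x) = (M((δ⁻¹γδ)·x))(δ·x)`.
[folklore] -/
theorem forall_exists_lift_linSubstEntries {M : Matrix ι ι (MvPolynomial σ k)}
    (hM : ∀ γ ∈ Γ, ∃ P Q : GL ι k, Matrix.linSubstEntries γ M =
      (P : Matrix ι ι k).map C * M * (Q : Matrix ι ι k).map C)
    {δ : GL σ k} (hδ : δ ∈ Γ) :
    ∀ γ ∈ Γ, ∃ P Q : GL ι k,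
      Matrix.linSubstEntries γ (Matrix.linSubstEntries δ M) =
        (P : Matrix ι ι k).map C * Matrix.linSubstEntries δ M * (Q : Matrix ι ι k).map C := by
  intro γ hγ
  obtain ⟨P, Q, e⟩ := hM (δ⁻¹ * γ * δ) (Γ.mul_mem (Γ.mul_mem (Γ.inv_mem hδ) hγ) hδ)
  refine ⟨P, Q, ?_⟩
  have hconj : γ * δ = δ * (δ⁻¹ * γ * δ) := by group
  rw [Matrix.linSubstEntries_linSubstEntries, hconj, ← Matrix.linSubstEntries_linSubstEntries, e,
    Matrix.linSubstEntries_mul, Matrix.linSubstEntries_mul, Matrix.linSubstEntries_map_C,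
    Matrix.linSubstEntries_map_C]

/-- Gauge lifts are transported along `DetReprEquivalent Γ`. [folklore] -/
theorem DetReprEquivalent.forall_exists_lift (h : DetReprEquivalent Γ A B)
    (hA : ∀ γ ∈ Γ, ∃ P Q : GL ι k, Matrix.linSubstEntries γ A =
      (P : Matrix ι ι k).map C * A * (Q : Matrix ι ι k).map C) :
    ∀ γ ∈ Γ, ∃ P Q : GL ι k,
      Matrix.linSubstEntries γ B = (P : Matrix ι ι k).map C * B * (Q : Matrix ι ι k).map C := by
  obtain ⟨P, Q, γ₀, hγ₀, hB⟩ := h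
  rcases hB with rfl | rfl
  · exact forall_exists_lift_mul_mul (forall_exists_lift_linSubstEntries hA hγ₀) P Q
  · exact forall_exists_lift_mul_mul
      (forall_exists_lift_transpose (forall_exists_lift_linSubstEntries hA hγ₀)) P Q

end API

/-! ### Link with `Γ`-equivariant representations (`EquivariantDC.lean`) -/

section Equivariant

variable [Fintype σ] [DecidableEq σ] {Γ : Subgroup (GL σ k)} {f : MvPolynomial σ k} {m : ℕ}
  {A B : Matrix (Fin m) (Fin m) (MvPolynomial σ k)}

/-- Exact-lift form of equivariance with the gauge factors written as `(P, Q)` instead of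
`(g, h⁻¹)`: `A` is `Γ`-equivariant iff it is an affine determinantal representation of `f` and every
`A(γ·x)`, `γ ∈ Γ`, equals `P · A · Q` for some constant invertible `P, Q` (Landsberg–Ressayre 2017,
Def. 1.3, concrete `GL_m × GL_m` form of `EquivariantDC.lean`). [cite: LandsbergRessayre2017, Def. 1.3] -/
theorem isEquivariantDetRepr_iff_exists_mul_mul :
    IsEquivariantDetRepr Γ f A ↔ IsAffineDetRepr f A ∧ ∀ γ ∈ Γ, ∃ P Q : GL (Fin m) k,
      Matrix.linSubstEntries γ A =
        (P : Matrix (Fin m) (Fin m) k).map C * A * (Q : Matrix (Fin m) (Fin m) k).map C := by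
  refine and_congr_right fun _ => forall₂_congr fun γ _ => ⟨?_, ?_⟩
  · rintro ⟨g, h, e⟩
    exact ⟨g, h⁻¹, e⟩
  · rintro ⟨P, Q, e⟩
    exact ⟨P, Q⁻¹, by rwa [inv_inv]⟩

/-- A `Γ`-equivariant representation is `⊥`-equivalent (gauge move alone, no substitution, no
transpose needed) to each of its substituted matrices `A(γ·x)`, `γ ∈ Γ` (Landsberg–Ressayre 2017,
Def. 1.3). [cite: LandsbergRessayre2017, Def. 1.3] -/
theorem IsEquivariantDetRepr.detReprEquivalent_bot (hA : IsEquivariantDetRepr Γ f A) {γ : GL σ k}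
    (hγ : γ ∈ Γ) : DetReprEquivalent ⊥ A (Matrix.linSubstEntries γ A) := by
  obtain ⟨P, Q, e⟩ := (isEquivariantDetRepr_iff_exists_mul_mul.1 hA).2 γ hγ
  rw [e]
  exact detReprEquivalent_mul_mul ⊥ A P Q

/-- **Equivariance is an orbit property.** If `A` is a `Γ`-equivariant representation of `f` and `B`
is `DetReprEquivalent Γ` to `A` with `det B = f`, then `B` is `Γ`-equivariant as well (the lifts are
conjugated along the moves). With `OptimalUnique`-type statements this is the implication
"optimal representations are unique up to symmetry ⇒ optimal representations are symmetric"
(Landsberg–Ressayre 2017, §2, Question 2.2). [cite: LandsbergRessayre2017, Def. 1.3] -/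
theorem IsEquivariantDetRepr.of_detReprEquivalent (hA : IsEquivariantDetRepr Γ f A)
    (h : DetReprEquivalent Γ A B) (hB : B.det = f) : IsEquivariantDetRepr Γ f B := by
  rw [isEquivariantDetRepr_iff_exists_mul_mul] at hA ⊢
  exact ⟨⟨h.totalDegree_le hA.1.1, hB⟩, h.forall_exists_lift hA.2⟩

end Equivariant

end Literature.Computability.AlgebraicComplexity

end
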